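import Literature.AlgebraicGeometry.AbelianSchemes.HomEqualityLocusClosed
import Literature.Topology.NoetherianSpaces.ClopenInterOfNoetherian
import HarnessLib

/-!
# An ARBITRARY family of equalities of homomorphisms of abelian schemes over a Noetherian base: ONE open-and-closed representing locus

Layer `Literature/AlgebraicGeometry/AbelianSchemes`, namespace `Literature.AlgebraicGeometry.AbelianSchemes.AbelianSchemeOver`.
THEOREMS ONLY (no definition, no named fact, no instance, no notation, no `sorry`).  Sequel of ★ `HomEqualityLocusClosed` (ONE pair:
`exists_opens_isClosed_forall_pullback_map_eq_iff`) and ★ `EndomorphismStructureLocus` §1 (a FINITE family: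
`exists_opens_isClosed_forall_iff_of_finite`).  Cell `hodgecm-mathlib` (D-0151), P6 «MOD programme» (crux hLiu418 = stmt-HodgeConjecture-24832),
line-candidate `F0_P6a_IsomSchemeFiniteType`, sub-organ **(Ib)** of `stub_ICON` (A-p14 (g34) census `CENSUS-ICON-IsomConditionsLocus.v1` §2): the
`Isom`-condition «`U` is `𝒪`-equivariant» is the family `(ι₁(a) ≫ U = U ≫ ι₂(a))_{a ∈ 𝒪}` indexed by the WHOLE order `𝒪` (no finite generating
set needs to be chosen).  HC_CM is proved only modulo the 2 remaining named inputs (hLiu418, h413) until rung 0 closes; generic, count-neutral.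

## The mathematics

For homomorphisms `f_j, g_j : A_j → B_j` (`j ∈ J`, ANY index type) of abelian schemes over a locally Noetherian `S`, each equality locus
`E(f_j, g_j)` is OPEN AND CLOSED and represents «`f_j ×_S T = g_j ×_S T`» on locally Noetherian `T` ([MumfordFogartyKirwan1994] Ch. 6 §1
Cor. 6.2 ∕ 6.4; ★).  If the underlying space of `S` is NOETHERIAN it has finitely many open-and-closed subsets, so `⋂_j E(f_j, g_j)` is again
open and closed (★ `Topology.NoetherianSpaces.isClopen_iInter_of_noetherianSpace`) and represents the conjunction «`∀ j, f_j ×_S T = g_j ×_S T`».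

* **`exists_opens_isClopen_forall_iff_of_noetherianSpace`** — the locus (stated `IsClopen`); **`exists_opens_isClosed_forall_iff_exists_comp_of_noetherianSpace`** — the factorisation form through `U ↪ S`.

## References
* [MumfordFogartyKirwan1994] D. Mumford, J. Fogarty, F. Kirwan, *Geometric Invariant Theory*, 3rd ed. (1994), Ch. 6 §1 Corollary 6.2 (p. 116),
  Corollary 6.4 (p. 117).
* [Kottwitz1992] R. Kottwitz, *Points on some Shimura varieties over finite fields*, JAMS 5 (1992), §5 (p. 390).
* [StacksProject] The Stacks Project, Tag 0052, Tag 04MF.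
-/

set_option autoImplicit false

noncomputable section

universe u

open CategoryTheory CategoryTheory.Limits AlgebraicGeometry TopologicalSpace
open scoped MonObj

namespace Literature.AlgebraicGeometry.AbelianSchemes

namespace AbelianSchemeOver

variable {S : Scheme.{u}} [IsLocallyNoetherian S] [NoetherianSpace S] {J : Type*} (A B : J → AbelianSchemeOver S)
  (f g : ∀ j, (A j).X ⟶ (B j).X) [∀ j, IsMonHom (f j)] [∀ j, IsMonHom (g j)]

/-- **An ARBITRARY family of equalities of homomorphisms of abelian schemes over a Noetherian base is represented by ONE open-and-closed
locus**: for `f_j, g_j : A_j → B_j` (`j ∈ J`, any `J`) over a locally Noetherian `S` with Noetherian underlying space there is an open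
`U ⊆ S` with closed underlying set such that for every locally Noetherian `T` and `u : T → S`: `f_j ×_S T = g_j ×_S T` for all `j` iff
`u(T) ⊆ U` (the intersection of the ★ loci `exists_opens_isClosed_forall_pullback_map_eq_iff`, open-and-closed by ★
`isClopen_iInter_of_noetherianSpace`). [cite: MumfordFogartyKirwan1994, Ch. 6 §1 Corollary 6.2 (p. 116) and Corollary 6.4 (p. 117)]
[cite: Kottwitz1992, §5 (p. 390)] -/
theorem exists_opens_isClopen_forall_iff_of_noetherianSpace :
    ∃ U : S.Opens, IsClopen (U : Set S) ∧ ∀ ⦃T : Scheme.{u}⦄ [IsLocallyNoetherian T] (u : T ⟶ S),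
      (∀ j, (Over.pullback u).map (f j) = (Over.pullback u).map (g j)) ↔ Set.range u.base ⊆ (U : Set S) := by
  choose U hUc hU using fun j => exists_opens_isClosed_forall_pullback_map_eq_iff (f j) (g j)
  have hclopen : IsClopen (⋂ j, (U j : Set S)) :=
    Literature.Topology.NoetherianSpaces.isClopen_iInter_of_noetherianSpace (fun j => (U j : Set S))
      fun j => ⟨hUc j, (U j).isOpen⟩
  refine ⟨⟨⋂ j, (U j : Set S), hclopen.isOpen⟩, hclopen, fun T _ u => ?_⟩
  change (∀ j, _) ↔ Set.range u.base ⊆ ⋂ j, (U j : Set S)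
  rw [Set.subset_iInter_iff]
  exact forall_congr' fun j => hU j u

/-- **Factorisation form**: `∀ j, f_j ×_S T = g_j ×_S T` iff `u : T → S` factors through the inclusion `U ↪ S` of the joint locus (an
open immersion with closed image; on a Noetherian `S` the open subscheme `U` is Noetherian, so `U ↪ S` is quasi-compact).
[cite: MumfordFogartyKirwan1994, Ch. 6 §1 Corollary 6.2 (p. 116) and Corollary 6.4 (p. 117)] [cite: Kottwitz1992, §5 (p. 390)] -/
theorem exists_opens_isClosed_forall_iff_exists_comp_of_noetherianSpace :
    ∃ U : S.Opens, IsClosed (U : Set S) ∧ ∀ ⦃T : Scheme.{u}⦄ [IsLocallyNoetherian T] (u : T ⟶ S),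
      (∀ j, (Over.pullback u).map (f j) = (Over.pullback u).map (g j)) ↔ ∃ u' : T ⟶ (U : Scheme.{u}), u' ≫ U.ι = u := by
  obtain ⟨U, hU, hrep⟩ := exists_opens_isClopen_forall_iff_of_noetherianSpace A B f g
  refine ⟨U, hU.isClosed, fun T _ u => (hrep u).trans ⟨fun h => ?_, ?_⟩⟩
  · have hr : Set.range u.base ⊆ Set.range U.ι.base := by rwa [Scheme.Opens.range_ι]
    exact ⟨IsOpenImmersion.lift U.ι u hr, IsOpenImmersion.lift_fac U.ι u hr⟩
  · rintro ⟨u', rfl⟩ _ ⟨t, rfl⟩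
    have ht : U.ι (u' t) ∈ Set.range U.ι := ⟨u' t, rfl⟩
    rw [Scheme.Opens.range_ι] at ht
    exact ht

end AbelianSchemeOver

end Literature.AlgebraicGeometry.AbelianSchemes

end
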